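import Summits.BirchSwinnertonDyer.BirchSwinnertonDyer.Theorems.ByReductionTypeAtTwoTowerLambdaRank
import Summits.BirchSwinnertonDyer.BirchSwinnertonDyer.Theorems.ByReductionTypeAtTwoTorsionEulerCharH46
import HarnessLib

/-!
# The TOWER doors for `BSD(E,2)` WITHOUT the print binder `hEC` (Greenberg Thm. 4.1 at `2`): the `…_noHEC` leaf

Cell `bsd-2adic` (run/shared/lean/pub/bsd-2adic/), seat `bsd-2adic-tower-1` GEN 39; `--supports stmt-BirchSwinnertonDyer-19271`
(helper, item `OrdKatoHalfAtTwo`, TOWER road). THEOREMS ONLY (no definition, no named fact, no instance, no `sorry`); closes no item;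
nothing booked; BSD is not proved by any of this. A NEW leaf (RC-500 (a) / RC-518: no rewrite of the landed doors
`…TowerLambdaPinch` p419348 / `…TowerLambdaRank` p419840): the binder `hEC : X5.O1.TwoAdicEulerCharRankZero W 0` of the two TOWER
doors for `BSDp W 2` is DISCHARGED by the kernel theorem `TorsionEulerChar.H46.twoAdicEulerCharRankZero W` (GEN 39:
Greenberg's Lemma 4.6 on `Γ`-invariants without (T₁), through the B6 universal-norm schedule).

* `bsdp_two_of_towerGap_of_lambda_le_noHEC` — `…TowerLambdaPinch.bsdp_two_of_towerGap_of_lambda_le` without `hEC`.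
* `bsdp_two_of_towerGap_of_towerRank_noHEC` — `…TowerLambdaRank.bsdp_two_of_towerGap_of_towerRank` without `hEC`.

What remains displayed on these doors: PRINT {modularity `hmod`, GZK `hGZK`, Kato 17.4 (1)(2)@2 `h17`, Greenberg Prop. 4.14
`h414` (tower-rank form only)} + certificates {`hper₀`, `TowerGapAtTwo W`, `λ_an = n`, `μ_an = 0`, `n ≤ λ(X)` resp. `TowerRank`}.
References: [GreenbergLNM1716] Thm. 4.1 (p. 102), §4 Lemma 4.6, Prop. 4.14; [Kato2004Asterisque] Thm. 17.4; [Miller2011LMS] Def. 1.1.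
-/

set_option autoImplicit false
-- the Theorems namespace of this sub repeats the summit name by design (D-0017 nested layout)
set_option linter.dupNamespace false

noncomputable section

open scoped Classical MatrixGroups ModularForm

open CongruenceSubgroup WeierstrassCurve Literature.NumberTheory.EllipticCurves
  Literature.NumberTheory.EllipticCurves.ModularForms Literature.NumberTheory.EllipticCurves.Rank1Residual
  Literature.NumberTheory.EllipticCurves.Rank1Residual.Typed
  Literature.NumberTheory.EllipticCurves.Greenberg1999
  Summit.BirchSwinnertonDyer.Rank1Residual.X1.MuLambda
  Summit.BirchSwinnertonDyer.Rank1Residual.X1.MuPart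
  Summit.BirchSwinnertonDyer.Rank1Residual.X1.ParitySqueeze
  Summit.BirchSwinnertonDyer.BirchSwinnertonDyer.Theorems.Rank1ResidualX1Defs
  Summit.BirchSwinnertonDyer.Rank1Residual.X5 Summit.BirchSwinnertonDyer.Rank1Residual.X5.O1
  Summit.BirchSwinnertonDyer.Rank1Residual.X5.TowerGap

namespace Summit.BirchSwinnertonDyer.BirchSwinnertonDyer.Theorems.KatoHalfPinch

variable (W : WeierstrassCurve ℚ) [W.IsElliptic] [W.IsGloballyMinimal]

/-- **Door (TOWER) for `BSD(E,2)` at analytic rank `0`, NO `hEC`:** PRINT {modularity, GZK, Kato 17.4 (1)(2)@2} + certificates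
{`hper₀`, `TowerGapAtTwo W`, `μ_an = 0`, `λ_an = n`, `n ≤ λ(X)`} ⇒ `BSDp W 2`; Greenberg's Thm. 4.1 at `2` is supplied by the kernel
theorem `TorsionEulerChar.H46.twoAdicEulerCharRankZero`. [cite: GreenbergLNM1716, Thm. 4.1 (p. 102), §4 Lemma 4.6 (p. 105)]
[cite: Kato2004Asterisque, Thm. 17.4 (1)(2) (p. 273)] [cite: Miller2011LMS, Def. 1.1] -/
theorem bsdp_two_of_towerGap_of_lambda_le_noHEC (hmod : nonempty_modularParametrizationData)
    (hGZK : rank_eq_analyticRank_of_analyticRank_le_one)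
    (h17 : ∀ [NeZero (W.conductorNorm ℤ)] (f : CuspForm (Gamma0 (W.conductorNorm ℤ)) 2),
      kato_divisibility_allPrimes W 2 (f := f))
    (hper₀ : ∀ [NeZero (W.conductorNorm ℤ)] (f : CuspForm (Gamma0 (W.conductorNorm ℤ)) 2),
      IsNewformOf W f → ∀ ϖ : ℚ, (ϖ : ℝ) * W.realPeriodRat = plusPeriod f → 0 ≤ padicValRat 2 ϖ)
    (hgo : GoodOrd W 2) (hr : W.analyticRank = 0) (hgap : TowerGapAtTwo W) {n : ℕ}
    (hlan : AnalyticLambdaEq W 2 n) (hμan : AnalyticMuLE W 2 0)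
    (hlamge : ∀ (κ : ZpExtension ℚ 2) (γ : Field.absoluteGaloisGroup ℚ), κ.IsCyclotomic →
      κ.IsTopGenerator γ → IsCyclotomicVariable 2 γ → ∀ D : W.SelmerDualData κ γ, n ≤ D.lambda) :
    BSDp W 2 :=
  bsdp_two_of_towerGap_of_lambda_le W hmod hGZK h17 (TorsionEulerChar.H46.twoAdicEulerCharRankZero W) hper₀ hgo hr hgap hlan
    hμan hlamge

/-- **Door (TOWER, certificate form) for `BSD(E,2)` at analytic rank `0`, NO `hEC`:** PRINT {modularity, GZK, Kato 17.4 (1)(2)@2,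
Greenberg Prop. 4.14@2} + certificates {`hper₀`, `TowerGapAtTwo W`, `TowerRank n`, `μ_an = 0`, `λ_an = n`} ⇒ `BSDp W 2`; Greenberg's
Thm. 4.1 at `2` is supplied by `TorsionEulerChar.H46.twoAdicEulerCharRankZero`. [cite: GreenbergLNM1716, Thm. 4.1 (p. 102), Prop. 4.14 (§4)]
[cite: Kato2004Asterisque, Thm. 17.4 (1)(2) (p. 273)] [cite: Miller2011LMS, Def. 1.1] -/
theorem bsdp_two_of_towerGap_of_towerRank_noHEC (hmod : nonempty_modularParametrizationData)
    (hGZK : rank_eq_analyticRank_of_analyticRank_le_one)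
    (h17 : ∀ [NeZero (W.conductorNorm ℤ)] (f : CuspForm (Gamma0 (W.conductorNorm ℤ)) 2),
      kato_divisibility_allPrimes W 2 (f := f))
    (h414 : prop414_noFiniteSubmodule_of_not_dvd_torsionOrder)
    (hper₀ : ∀ [NeZero (W.conductorNorm ℤ)] (f : CuspForm (Gamma0 (W.conductorNorm ℤ)) 2),
      IsNewformOf W f → ∀ ϖ : ℚ, (ϖ : ℝ) * W.realPeriodRat = plusPeriod f → 0 ≤ padicValRat 2 ϖ)
    (hgo : GoodOrd W 2) (hr : W.analyticRank = 0) (htors : ¬ 2 ∣ W.torsionOrder)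
    (hgap : TowerGapAtTwo W) {n : ℕ}
    (hrank : ∀ (κ : ZpExtension ℚ 2) (γ : Field.absoluteGaloisGroup ℚ), κ.IsCyclotomic →
      κ.IsTopGenerator γ → IsCyclotomicVariable 2 γ → ∀ D : W.SelmerDualData κ γ,
      ∃ j : ℕ, 2 ^ n ≤ Nat.card (D.X ⧸ (towerIdeal 2 j • ⊤ : Submodule (IwasawaAlgebra 2) D.X)))
    (hlan : AnalyticLambdaEq W 2 n) (hμan : AnalyticMuLE W 2 0) : BSDp W 2 :=
  bsdp_two_of_towerGap_of_towerRank W hmod hGZK h17 (TorsionEulerChar.H46.twoAdicEulerCharRankZero W) h414 hper₀ hgo hr htors hgap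
    hrank hlan hμan

end Summit.BirchSwinnertonDyer.BirchSwinnertonDyer.Theorems.KatoHalfPinch

end
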